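import Literature.AlgebraicGeometry.Modules.TensorProduct
import Literature.AlgebraicGeometry.Modules.SheafifyTorsionFree
import Literature.AlgebraicGeometry.FormalGeometry.WittGEFramesLocal
import Mathlib.LinearAlgebra.TensorProduct.Basis
import HarnessLib

/-!
# The tensor product of finite locally free `𝒪_X`-modules is finite locally free

The Stacks Project, Tag 01CE (Modules, Lemma 17.16.6 (7)), verbatim: "Let `(X, 𝒪_X)` be a ringed space.
Let `𝓕`, `𝓖` be `𝒪_X`-modules. […] (7) If `𝓕`, `𝓖` are locally free, so is `𝓕 ⊗_{𝒪_X} 𝓖`."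
Proof, ibid.: "This follows if we show that `(⊕_{i ∈ I} 𝒪_X) ⊗_{𝒪_X} (⊕_{j ∈ J} 𝒪_X) ≅
⊕_{(i,j) ∈ I × J} 𝒪_X`. The sheaf `⊕_{i ∈ I} 𝒪_X` is the sheaf associated to the presheaf
`U ↦ ⊕_{i ∈ I} 𝒪_X(U)`. Hence the tensor product is the sheaf associated to the presheaf
`U ↦ (⊕_{i ∈ I} 𝒪_X(U)) ⊗_{𝒪_X(U)} (⊕_{j ∈ J} 𝒪_X(U))`. We deduce what we want since for any ring
`R` we have `(⊕_{i ∈ I} R) ⊗_R (⊕_{j ∈ J} R) = ⊕_{(i,j) ∈ I × J} R`."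

This file proves (7) in the finite-rank case for the tree's tensor product `Modules.tensorObj M N`
(the sheafification of the presheaf `U ↦ M(U) ⊗_{𝒪_X(U)} N(U)`, `Modules/TensorProduct`, Stacks
01CA) and the tree's `Motives.IsFiniteLocallyFree` (Stacks 01C6 (2)):
`isFiniteLocallyFree_tensorObj`. The proof follows the printed one in the tree's FRAME language
(`FormalGeometry/WittGEFramesLocal`: a module is finite locally free iff near every point it has a
frame — finitely many sections `b_i` over `U` such that `a ↦ ∑ a_i b_i|_V` is a bijection
`𝒪_X(V)^ι → M(V)` for EVERY open `V ⊆ U`):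

* §1 `toSheafify_app_bijective_of_sheaf_below` — for ANY presheaf of abelian groups `P` on a
  topological space and an open `U` below which `P` already satisfies the sheaf axioms
  (separation and gluing for opens `V ⊆ U`), the sheafification map `P(V) → P♯(V)` is bijective for
  all `V ⊆ U` (`P → P♯` is locally injective and locally surjective, Mathlib; the content of Stacks
  007X with the proof of 0080, "`𝒢 = 𝒢♯` for a sheaf `𝒢`", localised to `U`);
* §2 frames as bases: a frame of `E` over `U` makes `E(V)` free on the restricted frame for
  `V ⊆ U` (`basisOfFrame`, Mathlib `Module.Basis.ofEquivFun`);
* §3 for a pair of frames of `M`, `N` over `U` (`FramePair`), the presheaf tensor product has the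
  basis `b_i|_V ⊗ c_j|_V` over every `V ⊆ U` (Mathlib `Module.Basis.tensorProduct` — the displayed
  identity `(⊕_I R) ⊗_R (⊕_J R) = ⊕_{I×J} R` of the printed proof), compatibly with restriction
  (`FramePair.resT_basis`, `coeff_resT`); hence below `U` it is separated (`FramePair.sep`) and
  satisfies gluing (`FramePair.glue`) because the structure sheaf does (Mathlib
  `TopCat.Sheaf.eq_of_locally_eq'`, `existsUnique_gluing'`);
* §4 so the unit `M ⊗_p N → M ⊗ N` is bijective on sections below `U`
  (`tensorUnitHom_app_bijective`) and the images of `b_i ⊗ c_j` form a frame of `M ⊗ N` over `U`: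
  `isFiniteLocallyFree_tensorObj`.

Everything is proved; no named facts, no instances. Use (Hodge programme, road №4, crux 26512,
item (M3)): the terms of an external tensor product of bounded complexes of vector bundles
(`Modules/BoxTensor.boxTensorComplex`) are vector bundles; library only — proves nothing about (N-U),
26512, №4, HC_AV or HC.

## References

* The Stacks Project, Tag 01CE (Modules, Lemma 17.16.6 (7)); Tag 01CA (tensor product presheaf
  and its sheafification); Tags 007X, 0080 (sheafification on spaces). [StacksProject]
* R. Hartshorne, *Algebraic Geometry*, GTM 52 (1977), II.5 p. 109 (locally free sheaves) and
  II Ex. 5.1 (b) (p. 123). [Hartshorne1977]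
-/

noncomputable section

open CategoryTheory CategoryTheory.Limits AlgebraicGeometry MonoidalCategory TopologicalSpace Opposite
open scoped TensorProduct

universe u

namespace Literature.AlgebraicGeometry.Modules

/-! ## §1 Sheafification does not change sections where the presheaf is already a sheaf -/

section SheafBelow

variable {X : TopCat.{u}} (P : (Opens X)ᵒᵖ ⥤ AddCommGrpCat.{u})

/-- **`P(V) → P♯(V)` is injective if `P` is separated below `U ⊇ V`.** If for every open `V ⊆ U`
a section of `P` over `V` that vanishes locally vanishes, then the sheafification map is injective
on `P(V)` for `V ⊆ U` (`P → P♯` is locally injective, Mathlib `isLocallyInjective_toSheafify`).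
[cite: StacksProject, Tag 007X (and proof of Tag 0080)] -/
theorem toSheafify_app_injective_of_separated_below (U : Opens X)
    (hsep : ∀ (V : Opens X), V ≤ U → ∀ s : P.obj (op V),
      (∀ x ∈ V, ∃ W : Opens X, x ∈ W ∧ ∃ i : W ≤ V, P.map (homOfLE i).op s = 0) → s = 0)
    (V : Opens X) (hV : V ≤ U) :
    Function.Injective ((toSheafify (Opens.grothendieckTopology X) P).app (op V)) := by
  change Function.Injective ((toSheafify (Opens.grothendieckTopology X) P).app (op V)).hom
  rw [injective_iff_map_eq_zero]
  intro s hs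
  refine hsep V hV s fun x hx => ?_
  have h1 : (toSheafify (Opens.grothendieckTopology X) P).app (op V) s =
      (toSheafify (Opens.grothendieckTopology X) P).app (op V) 0 := by
    rw [map_zero]; exact hs
  have h2 := Presheaf.equalizerSieve_mem (Opens.grothendieckTopology X)
    (toSheafify (Opens.grothendieckTopology X) P) s 0 h1
  obtain ⟨W, f, hf, hxW⟩ := (Opens.mem_grothendieckTopology X).1 h2 x hx
  change P.map f.op s = P.map f.op 0 at hf
  rw [map_zero] at hf
  exact ⟨W, hxW, f.le, hf⟩

/-- **`P(V) → P♯(V)` is bijective if `P` is a sheaf below `U ⊇ V`**: if `P` is separated below `U`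
and compatible families of sections on open covers of any `V ⊆ U` glue, then the sheafification
map `P(V) → P♯(V)` is bijective for every open `V ⊆ U` (local preimages, given by local
surjectivity of `P → P♯`, agree on overlaps by injectivity, glue in `P`, and map to the given
section since `P♯` is separated). The local form of "`𝒢 = 𝒢♯` for a sheaf `𝒢`".
[cite: StacksProject, Tag 007X (and proof of Tag 0080)] -/
theorem toSheafify_app_bijective_of_sheaf_below (U : Opens X)
    (hsep : ∀ (V : Opens X), V ≤ U → ∀ s : P.obj (op V),
      (∀ x ∈ V, ∃ W : Opens X, x ∈ W ∧ ∃ i : W ≤ V, P.map (homOfLE i).op s = 0) → s = 0)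
    (hglue : ∀ (V : Opens X), V ≤ U → ∀ (ι : Type u) (W : ι → Opens X) (iWV : ∀ i, W i ≤ V),
      V ≤ iSup W → ∀ s : ∀ i, P.obj (op (W i)), TopCat.Presheaf.IsCompatible P W s →
        ∃ t : P.obj (op V), ∀ i, P.map (homOfLE (iWV i)).op t = s i)
    (V : Opens X) (hV : V ≤ U) :
    Function.Bijective ((toSheafify (Opens.grothendieckTopology X) P).app (op V)) := by
  refine ⟨toSheafify_app_injective_of_separated_below P U hsep V hV, fun t => ?_⟩
  have hsurj : TopCat.Presheaf.IsLocallySurjective (toSheafify (Opens.grothendieckTopology X) P) :=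
    (inferInstance :
      Presheaf.IsLocallySurjective (Opens.grothendieckTopology X)
        (toSheafify (Opens.grothendieckTopology X) P))
  have key : ∀ x : V, ∃ W : Opens X, (x : X) ∈ W ∧ ∃ i : W ≤ V, ∃ s : P.obj (op W),
      (toSheafify (Opens.grothendieckTopology X) P).app (op W) s =
        ((presheafToSheaf (Opens.grothendieckTopology X) AddCommGrpCat.{u}).obj P).obj.map
          (homOfLE i).op t := by
    rintro ⟨x, hx⟩
    obtain ⟨W, hWV, ⟨s, hs⟩, hxW⟩ :=
      (TopCat.Presheaf.isLocallySurjective_iff _).1 hsurj V t x hx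
    exact ⟨W, hxW, hWV, s, hs⟩
  choose W hxW iWV s hs using key
  have hcover : V ≤ iSup W := fun x hx => Opens.mem_iSup.2 ⟨⟨x, hx⟩, hxW ⟨x, hx⟩⟩
  have hcompat : TopCat.Presheaf.IsCompatible P W s := by
    intro x y
    apply toSheafify_app_injective_of_separated_below P U hsep (W x ⊓ W y)
      ((inf_le_left.trans (iWV x)).trans hV)
    change (toSheafify (Opens.grothendieckTopology X) P).app (op (W x ⊓ W y))
        (P.map (homOfLE inf_le_left).op (s x)) =
      (toSheafify (Opens.grothendieckTopology X) P).app (op (W x ⊓ W y))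
        (P.map (homOfLE inf_le_right).op (s y))
    rw [toSheafify_app_map, toSheafify_app_map, hs, hs, ← CategoryTheory.comp_apply,
      ← Functor.map_comp, ← CategoryTheory.comp_apply, ← Functor.map_comp]
    rfl
  obtain ⟨t', ht'⟩ := hglue V hV _ W iWV hcover s hcompat
  refine ⟨t', ?_⟩
  refine TopCat.Sheaf.eq_of_locally_eq'
    ((presheafToSheaf (Opens.grothendieckTopology X) AddCommGrpCat.{u}).obj P) W V
    (fun x => homOfLE (iWV x)) hcover _ t fun x => ?_
  change ((presheafToSheaf (Opens.grothendieckTopology X) AddCommGrpCat.{u}).obj P).obj.map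
      (homOfLE (iWV x)).op ((toSheafify (Opens.grothendieckTopology X) P).app (op V) t') = _
  rw [← toSheafify_app_map, ht', hs]

end SheafBelow

/-! ## §2 Frames as bases -/

variable {X : Scheme.{u}}

/-- The ring of sections `𝒪_X(V)`, typed as the value at `V` of the presheaf of COMMUTATIVE rings
`X.sheaf.obj ⋙ forget₂ CommRingCat RingCat` over which `CommRingedPresheafOfModules X` (and hence
the presheaf tensor product of `Modules/TensorProduct`) lives; definitionally `Γ(X, V)`.
[cite: StacksProject, Tag 01CA] -/
abbrev secRing (X : Scheme.{u}) (V : X.Opens) : Type u :=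
  (X.sheaf.obj ⋙ forget₂ CommRingCat RingCat).obj (op V)

/-- Restriction `𝒪_X(V) → 𝒪_X(W)`, `W ⊆ V`, in the typing of `secRing`. [cite: StacksProject, Tag 01CA] -/
abbrev resRing {V W : X.Opens} (hW : W ≤ V) (r : secRing X V) : secRing X W :=
  (X.sheaf.obj ⋙ forget₂ CommRingCat RingCat).map (homOfLE hW).op r

/-- The sections `E(V)` of an `𝒪_X`-module as a `ModuleCat` over `secRing X V` (the value at `V`
of `toCommRingedPresheaf E`; definitionally `Γ(E, V)`). [cite: StacksProject, Tag 01CA] -/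
abbrev secMod (E : X.Modules) (V : X.Opens) : ModuleCat.{u} (secRing X V) :=
  (toCommRingedPresheaf E).obj (op V)

/-- Restriction `E(U) → E(V)`, `V ⊆ U`, landing in `secMod E V`. [cite: StacksProject, Tag 01CA] -/
abbrev res (E : X.Modules) {U V : X.Opens} (hV : V ≤ U) (s : Γ(E, U)) : secMod E V :=
  E.presheaf.map (homOfLE hV).op s

/-- Transitivity of restriction: `(s|_V)|_W = s|_W`. [cite: StacksProject, Tag 01CA] -/
lemma res_res (E : X.Modules) {U V W : X.Opens} (hV : V ≤ U) (hW : W ≤ V) (s : Γ(E, U)) :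
    res E hW (res E hV s) = res E (hW.trans hV) s := by
  change (E.presheaf.map (homOfLE hV).op ≫ E.presheaf.map (homOfLE hW).op) s = _
  rw [← Functor.map_comp]
  rfl

section Frames

variable {E : X.Modules} {U V : X.Opens} {ι : Type u} [Fintype ι]

/-- The frame map `a ↦ ∑_i a_i • b_i|_V` of sections `b_i ∈ E(U)` over `V ⊆ U`, as an
`𝒪_X(V)`-linear map `𝒪_X(V)^ι → E(V)` (Mathlib `Fintype.linearCombination`).
[cite: Hartshorne1977, II.5 p. 109 (free and locally free sheaves)] -/
def frameMap (b : ι → Γ(E, U)) (hV : V ≤ U) : (ι → secRing X V) →ₗ[secRing X V] secMod E V :=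
  Fintype.linearCombination (secRing X V) fun i => res E hV (b i)

/-- `frameMap b hV a = ∑_i a_i • b_i|_V`. [cite: Hartshorne1977, II.5 p. 109] -/
lemma frameMap_apply (b : ι → Γ(E, U)) (hV : V ≤ U) (a : ι → secRing X V) :
    frameMap b hV a = ∑ i, a i • res E hV (b i) :=
  Fintype.linearCombination_apply _ _ _

/-- A frame (in the sense of `FormalGeometry/WittGEFramesLocal`) has bijective frame map.
[cite: Hartshorne1977, II.5 p. 109] -/
lemma frameMap_bijective (b : ι → Γ(E, U)) (hV : V ≤ U)
    (hb : Function.Bijective fun a : ι → Γ(X, V) =>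
      ∑ i, a i • E.presheaf.map (homOfLE hV).op (b i)) :
    Function.Bijective (frameMap b hV) := by
  have h : ⇑(frameMap b hV) =
      fun a : ι → Γ(X, V) => ∑ i, a i • E.presheaf.map (homOfLE hV).op (b i) :=
    funext (frameMap_apply b hV)
  rw [h]; exact hb

/-- **A frame over `U` is a basis of `E(V)` for every `V ⊆ U`** (the restricted sections
`b_i|_V`; Mathlib `Module.Basis.ofEquivFun` of the inverse of the bijective frame map).
[cite: Hartshorne1977, II.5 p. 109 (free sheaves)] -/
def basisOfFrame (b : ι → Γ(E, U)) (hV : V ≤ U)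
    (hb : Function.Bijective fun a : ι → Γ(X, V) =>
      ∑ i, a i • E.presheaf.map (homOfLE hV).op (b i)) :
    Module.Basis ι (secRing X V) (secMod E V) :=
  Module.Basis.ofEquivFun
    (LinearEquiv.ofBijective (frameMap b hV) (frameMap_bijective b hV hb)).symm

/-- The basis vectors of `basisOfFrame` are the restricted frame sections `b_i|_V`.
[cite: Hartshorne1977, II.5 p. 109] -/
lemma basisOfFrame_apply (b : ι → Γ(E, U)) (hV : V ≤ U)
    (hb : Function.Bijective fun a : ι → Γ(X, V) =>
      ∑ i, a i • E.presheaf.map (homOfLE hV).op (b i))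
    (i : ι) : basisOfFrame b hV hb i = res E hV (b i) := by
  classical
  rw [basisOfFrame, Module.Basis.coe_ofEquivFun]
  change frameMap b hV (Function.update 0 i 1) = _
  rw [frameMap_apply]
  simp only [Function.update_apply, Pi.zero_apply, ite_smul, one_smul, zero_smul,
    Finset.sum_ite_eq', Finset.mem_univ, if_true]

end Frames

/-! ## §3 The presheaf tensor product below a common frame neighbourhood -/

variable (M N : X.Modules)

/-- The presheaf tensor product `U ↦ M(U) ⊗_{𝒪_X(U)} N(U)` (Mathlib's monoidal structure on
presheaves of modules), whose sheafification is the tree's `tensorObj M N`.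
[cite: StacksProject, Tag 01CA] -/
abbrev tensorPresheaf : CommRingedPresheafOfModules X :=
  (toCommRingedPresheaf M ⊗ toCommRingedPresheaf N : CommRingedPresheafOfModules X)

/-- The sections `M(V) ⊗_{𝒪_X(V)} N(V)` of the presheaf tensor product over `V` (definitionally the
value of `tensorPresheaf M N` at `V`). [cite: StacksProject, Tag 01CA] -/
abbrev TSec (V : X.Opens) : Type u := secMod M V ⊗[secRing X V] secMod N V

/-- Restriction `M(V) ⊗ N(V) → M(W) ⊗ N(W)` of the presheaf tensor product, `W ⊆ V`.
[cite: StacksProject, Tag 01CA] -/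
def resT {V W : X.Opens} (hW : W ≤ V) (s : TSec M N V) : TSec M N W :=
  ((tensorPresheaf M N).map (homOfLE hW).op : (tensorPresheaf M N).obj (op V) ⟶ _).hom s

variable {M N}

/-- `resT` is the restriction map of the underlying presheaf of abelian groups of
`tensorPresheaf M N` (`rfl`). [cite: StacksProject, Tag 01CA] -/
lemma resT_eq {V W : X.Opens} (hW : W ≤ V) (s : (tensorPresheaf M N).presheaf.obj (op V)) :
    (tensorPresheaf M N).presheaf.map (homOfLE hW).op s = resT M N hW s := rfl

/-- Restriction of a pure tensor: `(m ⊗ n)|_W = m|_W ⊗ n|_W` (Mathlib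
`PresheafOfModules.Monoidal.tensorObj_map_tmul`). [cite: StacksProject, Tag 01CA] -/
lemma resT_tmul {V W : X.Opens} (hW : W ≤ V) (m : secMod M V) (n : secMod N V) :
    resT M N hW (m ⊗ₜ n) = res M hW m ⊗ₜ res N hW n :=
  PresheafOfModules.Monoidal.tensorObj_map_tmul _ _ _

/-- `resT` is `𝒪_X(V)`-semilinear: `(r • s)|_W = r|_W • s|_W`. [cite: StacksProject, Tag 01CA] -/
lemma resT_smul {V W : X.Opens} (hW : W ≤ V) (r : secRing X V) (s : TSec M N V) :
    resT M N hW (r • s) = resRing hW r • resT M N hW s :=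
  (tensorPresheaf M N).map_smul _ _ _

/-- `resT` is additive on finite sums. [cite: StacksProject, Tag 01CA] -/
lemma resT_sum {V W : X.Opens} (hW : W ≤ V) {α : Type*} (t : Finset α) (f : α → TSec M N V) :
    resT M N hW (∑ a ∈ t, f a) = ∑ a ∈ t, resT M N hW (f a) :=
  map_sum ((tensorPresheaf M N).map (homOfLE hW).op).hom _ _

/-- **A common frame neighbourhood** of two `𝒪_X`-modules `M`, `N`: frames `b` of `M` and `c` of
`N` over the same open `U`, indexed by finite types `I`, `K`, i.e. finite families of sections whose
restrictions to every open `V ⊆ U` are bases of `M(V)`, `N(V)` (the hypothesis shape of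
`WittGEFramesLocal.isFiniteLocallyFree_of_frame_nhds`). Bookkeeping structure (data + the two
frame properties); no new mathematical notion. [cite: Hartshorne1977, II.5 p. 109 (locally free sheaves)] -/
structure FramePair (M N : X.Modules) (U : X.Opens) (I K : Type u) [Fintype I] [Fintype K] where
  /-- the frame sections of `M` over `U` -/
  b : I → Γ(M, U)
  /-- the frame sections of `N` over `U` -/
  c : K → Γ(N, U)
  /-- `b` is a frame: `a ↦ ∑ a_i b_i|_V` is bijective for every `V ⊆ U` -/
  hb : ∀ (V : X.Opens) (hV : V ≤ U), Function.Bijective fun a : I → Γ(X, V) =>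
    ∑ i, a i • M.presheaf.map (homOfLE hV).op (b i)
  /-- `c` is a frame -/
  hc : ∀ (V : X.Opens) (hV : V ≤ U), Function.Bijective fun a : K → Γ(X, V) =>
    ∑ i, a i • N.presheaf.map (homOfLE hV).op (c i)

namespace FramePair

variable {U : X.Opens} {I K : Type u} [Fintype I] [Fintype K] (F : FramePair M N U I K)

/-- **The basis `b_i|_V ⊗ c_j|_V` of `M(V) ⊗_{𝒪_X(V)} N(V)`** for `V ⊆ U` (Mathlib
`Module.Basis.tensorProduct`: the identity `(⊕_I R) ⊗_R (⊕_J R) = ⊕_{I×J} R` of the printed proof).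
[cite: StacksProject, Tag 01CE (proof of (7))] -/
def basis (V : X.Opens) (hV : V ≤ U) : Module.Basis (I × K) (secRing X V) (TSec M N V) :=
  (basisOfFrame F.b hV (F.hb V hV)).tensorProduct (basisOfFrame F.c hV (F.hc V hV))

/-- The basis vectors are the pure tensors `b_i|_V ⊗ c_j|_V`. [cite: StacksProject, Tag 01CE (proof of (7))] -/
lemma basis_apply (V : X.Opens) (hV : V ≤ U) (p : I × K) :
    F.basis V hV p = res M hV (F.b p.1) ⊗ₜ[secRing X V] res N hV (F.c p.2) := by
  rw [basis, Module.Basis.tensorProduct_apply', basisOfFrame_apply, basisOfFrame_apply]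

/-- Restriction carries the basis over `V` to the basis over `W ⊆ V`.
[cite: StacksProject, Tag 01CE (proof of (7))] -/
lemma resT_basis {V W : X.Opens} (hV : V ≤ U) (hW : W ≤ V) (p : I × K) :
    resT M N hW (F.basis V hV p) = F.basis W (hW.trans hV) p := by
  rw [basis_apply, basis_apply, resT_tmul, res_res, res_res]

/-- Restriction of a linear combination of the basis: the coefficients restrict.
[cite: StacksProject, Tag 01CE (proof of (7))] -/
lemma resT_sum_smul_basis {V W : X.Opens} (hV : V ≤ U) (hW : W ≤ V) (a : I × K → secRing X V) :
    resT M N hW (∑ p, a p • F.basis V hV p) = ∑ p, resRing hW (a p) • F.basis W (hW.trans hV) p := by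
  rw [resT_sum]
  refine Finset.sum_congr rfl fun p _ => ?_
  rw [resT_smul, resT_basis]

/-- The coefficients of a section of `M(V) ⊗ N(V)` in the basis `b_i|_V ⊗ c_j|_V`.
[cite: StacksProject, Tag 01CE (proof of (7))] -/
def coeff (V : X.Opens) (hV : V ≤ U) (s : TSec M N V) : I × K → secRing X V :=
  (F.basis V hV).equivFun s

/-- Basis expansion `s = ∑_p coeff(s)_p • (b ⊗ c)_p`. [cite: StacksProject, Tag 01CE (proof of (7))] -/
lemma sum_coeff_smul_basis (V : X.Opens) (hV : V ≤ U) (s : TSec M N V) :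
    ∑ p, F.coeff V hV s p • F.basis V hV p = s :=
  (F.basis V hV).sum_equivFun s

/-- The coefficients of `∑_p a_p • (b ⊗ c)_p` are `a`. [cite: StacksProject, Tag 01CE (proof of (7))] -/
lemma coeff_sum_smul_basis (V : X.Opens) (hV : V ≤ U) (a : I × K → secRing X V) :
    F.coeff V hV (∑ p, a p • F.basis V hV p) = a := by
  rw [coeff, ← Module.Basis.equivFun_symm_apply, LinearEquiv.apply_symm_apply]

/-- The coefficients of `0` vanish. [cite: StacksProject, Tag 01CE (proof of (7))] -/
lemma coeff_zero (V : X.Opens) (hV : V ≤ U) : F.coeff V hV 0 = 0 := by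
  rw [coeff, map_zero]

/-- **Naturality of the coefficients**: `coeff(s|_W) = coeff(s)|_W`.
[cite: StacksProject, Tag 01CE (proof of (7))] -/
lemma coeff_resT {V W : X.Opens} (hV : V ≤ U) (hW : W ≤ V) (s : TSec M N V) (p : I × K) :
    F.coeff W (hW.trans hV) (resT M N hW s) p = resRing hW (F.coeff V hV s p) := by
  conv_lhs => rw [← F.sum_coeff_smul_basis V hV s, resT_sum_smul_basis, coeff_sum_smul_basis]

include F in
/-- **Below a common frame neighbourhood the presheaf tensor product is separated**: a section of
`M(V) ⊗ N(V)`, `V ⊆ U`, that vanishes locally vanishes (its coefficients are sections of `𝒪_X`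
vanishing locally). [cite: StacksProject, Tag 01CE (proof of (7))] -/
theorem sep (V : X.Opens) (hV : V ≤ U) (s : TSec M N V)
    (h : ∀ x ∈ V, ∃ W : X.Opens, x ∈ W ∧ ∃ i : W ≤ V, resT M N i s = 0) : s = 0 := by
  rw [← F.sum_coeff_smul_basis V hV s]
  refine Finset.sum_eq_zero fun p _ => ?_
  suffices hz : F.coeff V hV s p = 0 by rw [hz, zero_smul]
  choose W hxW iWV hW using h
  have key : ∀ x : V, resRing (iWV x.1 x.2) (F.coeff V hV s p) = 0 := fun x => by
    rw [← coeff_resT, hW x.1 x.2, coeff_zero]; rfl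
  refine X.sheaf.eq_of_locally_eq' (fun x : V => W x.1 x.2) V (fun x => homOfLE (iWV x.1 x.2))
    (fun x hx => Opens.mem_iSup.2 ⟨⟨x, hx⟩, hxW x hx⟩) _ _ fun x => ?_
  change resRing (iWV x.1 x.2) (F.coeff V hV s p) = resRing (iWV x.1 x.2) 0
  rw [key x]
  exact (((X.sheaf.obj ⋙ forget₂ CommRingCat RingCat).map (homOfLE (iWV x.1 x.2)).op).hom.map_zero).symm

include F in
/-- **Below a common frame neighbourhood the presheaf tensor product satisfies gluing**: a
compatible family of sections of `M ⊗_p N` on an open cover of `V ⊆ U` glues (glue the coefficient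
families in the structure sheaf, Mathlib `TopCat.Sheaf.existsUnique_gluing'`).
[cite: StacksProject, Tag 01CE (proof of (7))] -/
theorem glue (V : X.Opens) (hV : V ≤ U) (ι' : Type u) (W : ι' → X.Opens) (iWV : ∀ i, W i ≤ V)
    (hcov : V ≤ iSup W) (s : ∀ i, TSec M N (W i))
    (hs : ∀ i j, resT M N (inf_le_left : W i ⊓ W j ≤ W i) (s i) =
      resT M N (inf_le_right : W i ⊓ W j ≤ W j) (s j)) :
    ∃ t : TSec M N V, ∀ i, resT M N (iWV i) t = s i := by
  -- the coefficient families of the local sections are compatible, hence glue in `𝒪_X`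
  have ha : ∀ p, TopCat.Presheaf.IsCompatible X.sheaf.obj W
      fun i => F.coeff (W i) ((iWV i).trans hV) (s i) p := by
    intro p i j
    change resRing inf_le_left (F.coeff (W i) _ (s i) p) =
      resRing inf_le_right (F.coeff (W j) _ (s j) p)
    rw [← coeff_resT (hW := inf_le_left), ← coeff_resT (hW := inf_le_right)]
    exact congrArg (fun q => F.coeff (W i ⊓ W j) _ q p) (hs i j)
  choose g hg _ using fun p => X.sheaf.existsUnique_gluing' W V (fun i => homOfLE (iWV i)) hcov
    (fun i => F.coeff (W i) ((iWV i).trans hV) (s i) p) (ha p)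
  let g' : I × K → secRing X V := g
  have hg' : ∀ p i, resRing (iWV i) (g' p) = F.coeff (W i) ((iWV i).trans hV) (s i) p :=
    fun p i => hg p i
  refine ⟨∑ p, g' p • F.basis V hV p, fun i => ?_⟩
  rw [resT_sum_smul_basis]
  simp_rw [hg']
  exact F.sum_coeff_smul_basis (W i) _ (s i)

end FramePair

/-! ## §4 The tensor product of finite locally free modules is finite locally free -/

open Literature.AlgebraicGeometry.Motives (IsFiniteLocallyFree)
open Literature.AlgebraicGeometry.FormalGeometry.WittGrothendieckExistence.FormalVectorBundlesAlgebraize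

variable (M N)

/-- The unit `M ⊗_p N → M ⊗ N` of the sheafification of presheaves of `𝒪_X`-modules at the
presheaf tensor product (the tree's `modulesSheafifyAdjunction`); on underlying presheaves of
abelian groups it is Mathlib's `toSheafify` (`rfl`). [cite: StacksProject, Tag 01CA] -/
def tensorUnitHom :
    tensorPresheaf M N ⟶ (Scheme.Modules.toPresheafOfModules X).obj (tensorObj M N) :=
  (modulesSheafifyAdjunction X).unit.app (tensorPresheaf M N)

/-- On sections the unit is `toSheafify` of the underlying abelian presheaf (`rfl`).
[cite: StacksProject, Tag 01CA] -/
lemma tensorUnitHom_app_apply (V : X.Opens) (q : TSec M N V) :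
    ((tensorUnitHom M N).app (op V) q : Γ(tensorObj M N, V)) =
      (toSheafify (Opens.grothendieckTopology X) (tensorPresheaf M N).presheaf).app (op V) q := rfl

/-- Naturality of the unit on sections: `(η_U q)|_V = η_V (q|_V)`. [cite: StacksProject, Tag 01CA] -/
lemma map_tensorUnitHom_app {U V : X.Opens} (hV : V ≤ U) (q : TSec M N U) :
    (tensorObj M N).presheaf.map (homOfLE hV).op ((tensorUnitHom M N).app (op U) q) =
      (tensorUnitHom M N).app (op V) (resT M N hV q) :=
  (toSheafify_app_map (tensorPresheaf M N).presheaf (homOfLE hV) q).symm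

/-- The unit is `𝒪_X(V)`-linear on sections. [cite: StacksProject, Tag 01CA] -/
lemma tensorUnitHom_app_smul (V : X.Opens) (a : secRing X V) (q : TSec M N V) :
    ((tensorUnitHom M N).app (op V) (a • q) : Γ(tensorObj M N, V)) =
      (a : Γ(X, V)) • (tensorUnitHom M N).app (op V) q :=
  ((tensorUnitHom M N).app (op V)).hom.map_smul a q

/-- The unit is additive on finite sums of sections. [cite: StacksProject, Tag 01CA] -/
lemma tensorUnitHom_app_sum (V : X.Opens) {α : Type*} (t : Finset α) (f : α → TSec M N V) :
    ((tensorUnitHom M N).app (op V) (∑ x ∈ t, f x) : Γ(tensorObj M N, V)) =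
      ∑ x ∈ t, (tensorUnitHom M N).app (op V) (f x) :=
  map_sum ((tensorUnitHom M N).app (op V)).hom _ _

/-- **Below a common frame neighbourhood `U` the unit `M(V) ⊗ N(V) → (M ⊗ N)(V)` is bijective**
for every `V ⊆ U` ("the tensor product is the sheaf associated to the presheaf
`U ↦ (⊕_I 𝒪_X(U)) ⊗ (⊕_J 𝒪_X(U))`", which below `U` is already a sheaf: §1 with `FramePair.sep`,
`FramePair.glue`). [cite: StacksProject, Tag 01CE (proof of (7))] -/
theorem tensorUnitHom_app_bijective {U : X.Opens} {I K : Type u} [Fintype I] [Fintype K]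
    (F : FramePair M N U I K) (V : X.Opens) (hV : V ≤ U) :
    Function.Bijective ((tensorUnitHom M N).app (op V)) := by
  change Function.Bijective
    ((toSheafify (Opens.grothendieckTopology X) (tensorPresheaf M N).presheaf).app (op V))
  exact toSheafify_app_bijective_of_sheaf_below (tensorPresheaf M N).presheaf U
    (fun V hV s h => F.sep V hV s h)
    (fun V hV ι' W iWV hcov s hs => F.glue V hV ι' W iWV hcov s hs) V hV

/-- **Two finite locally free modules have a common frame neighbourhood at every point** (intersect
a frame neighbourhood of `M` with one of `N` and restrict the frames;
`WittGEFramesLocal.exists_frame_nhds_of_isFiniteLocallyFree`).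
[cite: Hartshorne1977, II.5 p. 109 (locally free sheaves)] -/
theorem exists_framePair (hM : IsFiniteLocallyFree M) (hN : IsFiniteLocallyFree N) (x : X) :
    ∃ U : X.Opens, x ∈ U ∧ ∃ (I K : Type u) (_ : Fintype I) (_ : Fintype K),
      Nonempty (FramePair M N U I K) := by
  obtain ⟨U₁, hx₁, ι, _, b, hb⟩ :=
    PushforwardTransport.exists_frame_nhds_of_isFiniteLocallyFree hM x
  obtain ⟨U₂, hx₂, κ, _, c, hc⟩ :=
    PushforwardTransport.exists_frame_nhds_of_isFiniteLocallyFree hN x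
  have hb' : ∀ (V : X.Opens) (hV : V ≤ U₁ ⊓ U₂), Function.Bijective fun a : ι → Γ(X, V) =>
      ∑ i, a i • M.presheaf.map (homOfLE hV).op
        (M.presheaf.map (homOfLE (inf_le_left : U₁ ⊓ U₂ ≤ U₁)).op (b i)) := by
    intro V hV
    have h : ∀ i, M.presheaf.map (homOfLE hV).op
        (M.presheaf.map (homOfLE (inf_le_left : U₁ ⊓ U₂ ≤ U₁)).op (b i)) =
          M.presheaf.map (homOfLE (hV.trans inf_le_left)).op (b i) :=
      fun i => res_res M inf_le_left hV (b i)
    simp_rw [h]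
    exact hb V (hV.trans inf_le_left)
  have hc' : ∀ (V : X.Opens) (hV : V ≤ U₁ ⊓ U₂), Function.Bijective fun a : κ → Γ(X, V) =>
      ∑ i, a i • N.presheaf.map (homOfLE hV).op
        (N.presheaf.map (homOfLE (inf_le_right : U₁ ⊓ U₂ ≤ U₂)).op (c i)) := by
    intro V hV
    have h : ∀ j, N.presheaf.map (homOfLE hV).op
        (N.presheaf.map (homOfLE (inf_le_right : U₁ ⊓ U₂ ≤ U₂)).op (c j)) =
          N.presheaf.map (homOfLE (hV.trans inf_le_right)).op (c j) :=
      fun j => res_res N inf_le_right hV (c j)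
    simp_rw [h]
    exact hc V (hV.trans inf_le_right)
  exact ⟨U₁ ⊓ U₂, ⟨hx₁, hx₂⟩, ι, κ, inferInstance, inferInstance, ⟨FramePair.mk
    (fun i => M.presheaf.map (homOfLE (inf_le_left : U₁ ⊓ U₂ ≤ U₁)).op (b i))
    (fun j => N.presheaf.map (homOfLE (inf_le_right : U₁ ⊓ U₂ ≤ U₂)).op (c j)) hb' hc'⟩⟩

/-- **The tensor product of two finite locally free `𝒪_X`-modules is finite locally free**
(Stacks 01CE (7), finite-rank case, for the tree's `tensorObj` and `IsFiniteLocallyFree`): over a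
common frame neighbourhood `U` the sections `η_U(b_i ⊗ c_j)` form a frame of `M ⊗ N` — for
`V ⊆ U`, `a ↦ ∑ a_{ij} • η_U(b_i ⊗ c_j)|_V = η_V(∑ a_{ij} • b_i|_V ⊗ c_j|_V)` is the composite of
the basis isomorphism `𝒪_X(V)^{I×K} ≅ M(V) ⊗ N(V)` and the bijection `η_V`
(`tensorUnitHom_app_bijective`); conclude by `WittGEFramesLocal.isFiniteLocallyFree_of_frame_nhds`.
[cite: StacksProject, Tag 01CE (Lemma 17.16.6 (7))] -/
theorem isFiniteLocallyFree_tensorObj (hM : IsFiniteLocallyFree M) (hN : IsFiniteLocallyFree N) :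
    IsFiniteLocallyFree (tensorObj M N) := by
  refine PushforwardTransport.isFiniteLocallyFree_of_frame_nhds fun x => ?_
  obtain ⟨U, hxU, I, K, _, _, ⟨F⟩⟩ := exists_framePair M N hM hN x
  refine ⟨U, hxU, I × K, inferInstance,
    fun p => (tensorUnitHom M N).app (op U) (F.basis U le_rfl p), fun V hV => ?_⟩
  have key : (fun a : I × K → Γ(X, V) =>
      ∑ p, a p • (tensorObj M N).presheaf.map (homOfLE hV).op
        ((tensorUnitHom M N).app (op U) (F.basis U le_rfl p))) =
      (fun q => (tensorUnitHom M N).app (op V) q) ∘ fun a : I × K → secRing X V =>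
        ∑ p, a p • F.basis V hV p := by
    funext a
    simp only [Function.comp_apply]
    rw [tensorUnitHom_app_sum]
    refine Finset.sum_congr rfl fun p _ => ?_
    rw [map_tensorUnitHom_app, F.resT_basis, tensorUnitHom_app_smul]
    rfl
  have hbij : Function.Bijective fun a : I × K → secRing X V => ∑ p, a p • F.basis V hV p := by
    have hsymm : (fun a : I × K → secRing X V => ∑ p, a p • F.basis V hV p) =
        ⇑(F.basis V hV).equivFun.symm :=
      funext fun a => ((F.basis V hV).equivFun_symm_apply a).symm
    rw [hsymm]
    exact (F.basis V hV).equivFun.symm.bijective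
  rw [key]
  exact (tensorUnitHom_app_bijective M N F V hV).comp hbij

end Literature.AlgebraicGeometry.Modules

end
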